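import Literature.NumberTheory.EllipticCurves.StripIntegralVanishing
import Mathlib.MeasureTheory.Group.FundamentalDomain
import Mathlib.NumberTheory.Modular
import Literature.NumberTheory.EllipticCurves.ModularParametrizationDegreeProofs
import HarnessLib

/-!
# The conjugated strip `σ⁻¹ • {0 ≤ Re w < n}` is a fundamental domain for a group acting by conjugated translations

[[cite: Shintani1975, §2, proof of Prop. 2.3 (p. 103)]] — in the unfolding of Shintani's theta
lift the stabiliser `Γ_x` of a non-zero NULL vector is `σ⁻¹ {T^{nm}} σ` for some `σ ∈ SL₂(ℤ)`
moving its double root to `∞`; the orbit integral over `Γ_x∖ℍ` is computed on the strip.  We PROVE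
(for Mathlib's `MeasureTheory.IsFundamentalDomain`):

* **`isFundamentalDomain_conj_hstrip`** — if a group `Γ'` acts on `ℍ` with
  `σ(γ w) = (n m(γ)) +ᵥ σ w` for a bijection `m : Γ' → ℤ` and `n > 0`, then `σ⁻¹ • hstrip n` is a
  fundamental domain for `Γ'` (exact tiling: translate `Re(σw)` into `[0, n)`; distinct translates
  are disjoint);
* `isFundamentalDomain_univ_of_subsingleton` — for the trivial group `ℍ` itself is one (the case
  of DEFINITE vectors, whose stabilisers in `Γ₀(N)⁺` are trivial, `Gamma0PlusFreeAction`).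

No named facts, no definitions.
-/

noncomputable section

open scoped MatrixGroups Topology Pointwise
open UpperHalfPlane hiding I
open Complex Filter MeasureTheory Set

namespace Literature.NumberTheory.EllipticCurves.ModularForms

/-- Real translation by `t` moves the strip: `Re (t +ᵥ w) = Re w + t`. [folklore] -/
theorem re_vadd (t : ℝ) (w : ℍ) : (((t +ᵥ w : ℍ) : ℂ)).re = (w : ℂ).re + t := by
  rw [UpperHalfPlane.coe_vadd]; simp [add_comm]

/-- **The conjugated strip is a fundamental domain.** Let a group `Γ'` act on `ℍ` through
translations conjugated by `σ ∈ SL₂(ℤ)`: `σ • (γ • w) = (n · m(γ)) +ᵥ (σ • w)` with `m : Γ' → ℤ`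
bijective and `n > 0`.  Then `σ⁻¹ • {0 ≤ Re w < n}` is a fundamental domain for `Γ'` (exact
tiling: every orbit meets it, distinct translates are disjoint). [folklore] -/
theorem isFundamentalDomain_conj_hstrip {Γ' : Type*} [Group Γ'] [MulAction Γ' ℍ] (σ : SL(2, ℤ))
    {n : ℝ} (hn : 0 < n) (m : Γ' → ℤ) (hm : Function.Bijective m)
    (hact : ∀ (γ : Γ') (w : ℍ), σ • (γ • w) = ((n * m γ : ℝ)) +ᵥ (σ • w)) :
    IsFundamentalDomain Γ' (σ⁻¹ • hstrip n) (volume : Measure ℍ) where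
  nullMeasurableSet := by
    have : σ⁻¹ • hstrip n = (fun w : ℍ ↦ σ • w) ⁻¹' hstrip n := by
      ext w
      rw [Set.mem_smul_set_iff_inv_smul_mem, inv_inv, Set.mem_preimage]
    rw [this]
    exact ((measurableSet_hstrip n).preimage (continuous_sl2z_smul σ).measurable).nullMeasurableSet
  ae_covers := by
    refine Eventually.of_forall fun w ↦ ?_
    -- translate `Re (σ w)` into `[0, n)`
    set x : ℝ := ((σ • w : ℍ) : ℂ).re with hx
    obtain ⟨γ, hγ⟩ := hm.2 (-⌊x / n⌋)
    refine ⟨γ, ?_⟩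
    rw [Set.mem_smul_set_iff_inv_smul_mem, inv_inv, hact γ w, hγ]
    refine ⟨?_, ?_⟩
    · rw [re_vadd, ← hx]
      push_cast
      have h1 := Int.floor_le (x / n)
      have : (⌊x / n⌋ : ℝ) * n ≤ x := by rwa [le_div_iff₀ hn] at h1
      nlinarith
    · rw [re_vadd, ← hx]
      push_cast
      have h1 := Int.lt_floor_add_one (x / n)
      have : x < ((⌊x / n⌋ : ℝ) + 1) * n := by rwa [div_lt_iff₀ hn] at h1
      nlinarith
  aedisjoint := by
    intro γ γ' hne
    refine Disjoint.aedisjoint ?_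
    change Disjoint (γ • (σ⁻¹ • hstrip n)) (γ' • (σ⁻¹ • hstrip n))
    rw [Set.disjoint_left]
    rintro w ⟨u, hu, rfl⟩ ⟨u', hu', heq⟩
    -- `u = σ⁻¹ s`, `u' = σ⁻¹ s'` with `s, s'` in the strip and `γ u = γ' u'`
    rw [Set.mem_smul_set_iff_inv_smul_mem, inv_inv] at hu hu'
    have h1 : σ • (γ • u) = ((n * m γ : ℝ)) +ᵥ (σ • u) := hact γ u
    have h2 : σ • (γ' • u') = ((n * m γ' : ℝ)) +ᵥ (σ • u') := hact γ' u'
    have heq' : σ • (γ' • u') = σ • (γ • u) := by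
      have : γ' • u' = γ • u := heq
      rw [this]
    rw [h1, h2] at heq'
    have hre := congrArg (fun z : ℍ ↦ ((z : ℂ)).re) heq'
    simp only [re_vadd] at hre
    -- `Re(σu') + n m(γ') = Re(σu) + n m(γ)` with both real parts in `[0, n)` forces `m γ = m γ'`
    have hmm : m γ = m γ' := by
      by_contra hc
      rcases lt_or_gt_of_ne hc with hlt | hlt
      · have : (m γ : ℝ) + 1 ≤ m γ' := by exact_mod_cast hlt
        nlinarith [hu.1, hu.2, hu'.1, hu'.2]
      · have : (m γ' : ℝ) + 1 ≤ m γ := by exact_mod_cast hlt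
        nlinarith [hu.1, hu.2, hu'.1, hu'.2]
    exact hne (hm.1 hmm)

/-- For the trivial group, all of `ℍ` is a fundamental domain. [folklore] -/
theorem isFundamentalDomain_univ_of_subsingleton {Γ' : Type*} [Group Γ'] [MulAction Γ' ℍ]
    [Subsingleton Γ'] : IsFundamentalDomain Γ' (Set.univ : Set ℍ) (volume : Measure ℍ) where
  nullMeasurableSet := MeasurableSet.univ.nullMeasurableSet
  ae_covers := Eventually.of_forall fun _ ↦ ⟨1, Set.mem_univ _⟩
  aedisjoint := fun γ γ' hne ↦ absurd (Subsingleton.elim γ γ') hne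

end Literature.NumberTheory.EllipticCurves.ModularForms
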